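import Summits.CriticalPhenomena.Ising3D.Control2DReadoutTail
import Mathlib.Analysis.Normed.Ring.InfiniteSum
import Mathlib.Tactic.Linarith
import Mathlib.Tactic.Positivity
import Mathlib.Tactic.FieldSimp
import Mathlib.Tactic.Ring
import HarnessLib

/-!
# Readout certificates for SPINNING channels, analytic half: a two-sided tail bound for the spin-`ℓ` global block
under the table functional at `(1/2,1/2)` (cell `pub-ising3x`, seat controls-1 gen 30; KERNEL PATH, certificate kind
"readout", spin-`ℓ` extension — CONTROL-ONLY)

HONEST FRAMING: lottery ticket; floor = tightest certified 3D Ising CFT bounds; no exact-solution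
claim without a proof. CONTROL-ONLY (`d = 2`); nothing numerical is asserted here.

`Control2DReadoutTail.abs_phi_block0_sub_QN_le` (controls-1 g29) bounds the dropped `z`-series tail of the SCALAR block
(`ℓ = 0`, `Δ ≤ 2(1+√2)`), which is what the readout certificates of the T-2 nodes (`dip0_BΛ`) needed. The C-F evidence
(STRUCTURE.md §2, E-3) also reads the spin-2 channel (first `ℓ = 2` near-zero above the 2D Ising level `Δ = 6`), whose block
`g_{Δ,2}` has chiral weights `h = Δ/2 + 1 ≈ 4` outside that lemma's range. This file proves the bound for EVERY spin `ℓ` and every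
dimension `ℓ ≤ Δ ≤ 2k + ℓ` (`k ≥ 1` an integer "room" parameter; `c = k + ℓ`, so `h = (Δ+ℓ)/2 ≤ c`, `h̄ = (Δ-ℓ)/2 ≤ k`):
  `|φ[F_-[g_{Δ,ℓ}]] - φ[F_-[Q_N(Δ,ℓ)]]| ≤ (1/2)^{2s} (1/2)^Δ · 2W · A_c A_k · σ (2 S_N + σ)`,
`A_n = a_{n²-2n}(n)` the PEAK chiral coefficient (`chiralCoeff_le_peak`: `a_m(h) ≤ a_{n²-2n}(n)` for all `m` and `0 ≤ h ≤ n` — the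
factors `(n+i)²/((i+1)(2n+i))` of `a_m(n)` exceed `1` exactly while `i < n² - 2n`, and `a_m` is non-decreasing in `h`),
`σ = 2^{c+1} · tailMajor Λ (N+c+1)`, `S_N = Σ_{m<N} 2^{-m} C(m+Λ+c+1, Λ)`, for `0 ≤ s ≤ 1`, table indices `≤ Λ`, `Λ < N + c + 2`
(`abs_phi_block_sub_QN_le_spin`). Same architecture as the scalar lemma: the pair monomial `pairPow (h+m) (h̄+m')` is
`pairPow (b+J) b` with `b` the smaller exponent (case split on the sign of `ℓ + m - m'`), bounded by
`abs_taylorFunctional2D_half_pairPow_le_real` with `n_b = m' + k` resp. `m + c`; geometric tail `tsum_tail_le_tailMajor`; termwise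
action of `φ` (`hasSummableGerms_pairPow`, any `ℓ`). With `ℓ = 0`, `k = 3` it is the scalar lemma up to the constant `A`.
PROVED; no facts, standard axioms only. The kernel form (exact rational heads for `(h, h̄)` + this bound ⇒ one Boolean per
object) is `Control2DReadoutSpinKernel`. [cite: RattazziEtAl2008, §5.5]
-/

namespace Summit.CriticalPhenomena.Ising3D.Control2D

open Finset Set
open Literature.MathematicalPhysics.QuantumFieldTheory.ConformalBootstrap3D

/-! ### The peak bound `a_m(h) ≤ a_{c²-2c}(c)` for `0 ≤ h ≤ c` -/

/-- For a positive integer weight `c`, the factor `φ_i(c) = (c+i)²/((i+1)(2c+i))` is `≤ 1` once `i ≥ c² - 2c`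
(`(c+i)² ≤ (i+1)(2c+i) ⇔ c² ≤ 2c + i`). [folklore] -/
theorem chiralFactor_natCast_le_one {c i : ℕ} (hc : 0 < c) (hi : c * c - 2 * c ≤ i) : chiralFactor i (c : ℝ) ≤ 1 := by
  have hci : c * c ≤ i + 2 * c := by omega
  have hR : (c : ℝ) * c ≤ i + 2 * c := by exact_mod_cast hci
  have hcpos : (0 : ℝ) < c := by exact_mod_cast hc
  rw [chiralFactor_eq_of_pos hcpos i, div_le_one (by positivity)]
  nlinarith

/-- … and `≥ 1` while `i < c² - 2c`. [folklore] -/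
theorem one_le_chiralFactor_natCast {c i : ℕ} (hc : 0 < c) (hi : i < c * c - 2 * c) : 1 ≤ chiralFactor i (c : ℝ) := by
  have hci : i + 2 * c ≤ c * c := by omega
  have hR : (i : ℝ) + 2 * c ≤ c * c := by exact_mod_cast hci
  have hcpos : (0 : ℝ) < c := by exact_mod_cast hc
  rw [chiralFactor_eq_of_pos hcpos i, one_le_div (by positivity)]
  nlinarith

/-- The product form at an integer weight `c > 0` peaks at `m = c² - 2c`: `∏_{i<m} φ_i(c) ≤ ∏_{i<c²-2c} φ_i(c)` for every `m`.
[folklore] -/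
theorem chiralProd_natCast_le_peak {c : ℕ} (hc : 0 < c) (m : ℕ) :
    chiralProd (c : ℝ) m ≤ chiralProd (c : ℝ) (c * c - 2 * c) := by
  have h0c : (0 : ℝ) ≤ c := Nat.cast_nonneg c
  unfold chiralProd
  rcases le_or_gt m (c * c - 2 * c) with hle | hlt
  · rw [← Finset.prod_range_mul_prod_Ico _ hle]
    have h1 : (1 : ℝ) ≤ ∏ i ∈ Ico m (c * c - 2 * c), chiralFactor i (c : ℝ) := by
      calc (1 : ℝ) = ∏ _i ∈ Ico m (c * c - 2 * c), (1 : ℝ) := by simp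
        _ ≤ ∏ i ∈ Ico m (c * c - 2 * c), chiralFactor i (c : ℝ) :=
            Finset.prod_le_prod (fun _ _ => zero_le_one) fun i hi =>
              one_le_chiralFactor_natCast hc (Finset.mem_Ico.mp hi).2
    have h0 : 0 ≤ ∏ i ∈ range m, chiralFactor i (c : ℝ) := Finset.prod_nonneg fun i _ => chiralFactor_nonneg i h0c
    calc ∏ i ∈ range m, chiralFactor i (c : ℝ) = (∏ i ∈ range m, chiralFactor i (c : ℝ)) * 1 := (mul_one _).symm
      _ ≤ (∏ i ∈ range m, chiralFactor i (c : ℝ)) * ∏ i ∈ Ico m (c * c - 2 * c), chiralFactor i (c : ℝ) :=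
          mul_le_mul_of_nonneg_left h1 h0
  · rw [← Finset.prod_range_mul_prod_Ico _ hlt.le]
    have h1 : ∏ i ∈ Ico (c * c - 2 * c) m, chiralFactor i (c : ℝ) ≤ 1 :=
      Finset.prod_le_one (fun i _ => chiralFactor_nonneg i h0c) fun i hi =>
        chiralFactor_natCast_le_one hc (Finset.mem_Ico.mp hi).1
    have h0 : 0 ≤ ∏ i ∈ range (c * c - 2 * c), chiralFactor i (c : ℝ) :=
      Finset.prod_nonneg fun i _ => chiralFactor_nonneg i h0c
    calc (∏ i ∈ range (c * c - 2 * c), chiralFactor i (c : ℝ)) * ∏ i ∈ Ico (c * c - 2 * c) m, chiralFactor i (c : ℝ)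
        ≤ (∏ i ∈ range (c * c - 2 * c), chiralFactor i (c : ℝ)) * 1 := mul_le_mul_of_nonneg_left h1 h0
      _ = ∏ i ∈ range (c * c - 2 * c), chiralFactor i (c : ℝ) := mul_one _

/-- **Peak bound**: `a_m(h) ≤ a_{c²-2c}(c)` for all `m`, `0 ≤ h ≤ c` (`c` a positive integer): `a_m` is non-decreasing in `h`
(`chiralCoeff_mono`) and at `h = c` the sequence `m ↦ a_m(c)` increases up to `m = c² - 2c` and decreases after. (`c = 1, 2`: bound `1`;
`c = 3`: `a_3(3) = 25/14`; `c = 4`: `a_8(4) ≈ 4.23`; `c = 5`: `a_15(5) ≈ 11.49`.) [folklore] -/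
theorem chiralCoeff_le_peak {c : ℕ} (hc : 0 < c) {h : ℝ} (h0 : 0 ≤ h) (hhc : h ≤ c) (m : ℕ) :
    chiralCoeff h m ≤ chiralCoeff (c : ℝ) (c * c - 2 * c) := by
  have h0c : (0 : ℝ) ≤ c := Nat.cast_nonneg c
  refine (chiralCoeff_mono h0 hhc m).trans ?_
  rw [chiralCoeff_eq_prod h0c, chiralCoeff_eq_prod h0c]
  exact chiralProd_natCast_le_peak hc m

/-- The peak value is `≥ 1` (it dominates `a_0 = 1`). [folklore] -/
theorem one_le_chiralCoeff_peak {c : ℕ} (hc : 0 < c) : 1 ≤ chiralCoeff (c : ℝ) (c * c - 2 * c) := by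
  have h0c : (0 : ℝ) ≤ c := Nat.cast_nonneg c
  have h := chiralCoeff_le_peak hc h0c le_rfl 0
  rwa [chiralCoeff_eq_prod h0c 0, chiralProd, Finset.prod_range_zero] at h

/-! ### The two-sided majorant theorem for the spin-`ℓ` block -/

/-- **Two-sided tail bound for the spin-`ℓ` global block under the table functional at `(1/2,1/2)`** (`0 ≤ s ≤ 1`, table indices
`≤ Λ`, `ℓ ≤ Δ ≤ 2k + ℓ`, `0 < k`, `Λ < N + (k+ℓ) + 2`; write `c = k + ℓ`): with `A = a_{c²-2c}(c) · a_{k²-2k}(k)`,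
`σ = 2^{c+1} · tailMajor Λ (N+c+1)`, `S_N = Σ_{m<N} 2^{-m} C(m+Λ+c+1, Λ)` (written out),
`|φ[F_-[g_{Δ,ℓ}]] - φ[F_-[Q_N(Δ,ℓ)]]| ≤ (1/2)^{2s} (1/2)^Δ · 2W · A · σ (2 S_N + σ)`. PROVED. [cite: RattazziEtAl2008, §5.5] -/
theorem abs_phi_block_sub_QN_le_spin (S : Finset (ℕ × ℕ)) (w : ℕ × ℕ → ℝ) {s : ℝ} (hs0 : 0 ≤ s) (hs1 : s ≤ 1)
    {Λ : ℕ} (hΛ : ∀ p ∈ S, p.1 ≤ Λ ∧ p.2 ≤ Λ) (ℓ : ℕ) {k : ℕ} (hk : 0 < k) {Δ : ℝ} (hℓΔ : (ℓ : ℝ) ≤ Δ)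
    (hΔk : Δ ≤ 2 * k + ℓ) {N : ℕ} (hN : Λ < N + (k + ℓ) + 2) :
    |taylorFunctional2D (1 / 2) S w (crossF s (-1) (globalBlock Δ ℓ)) -
        taylorFunctional2D (1 / 2) S w (crossF s (-1) (QN N ℓ Δ))| ≤
      (1 / 2 : ℝ) ^ s * (1 / 2 : ℝ) ^ s * (1 / 2 : ℝ) ^ Δ * (2 * absWeight S w) *
        (chiralCoeff ((k + ℓ : ℕ) : ℝ) ((k + ℓ) * (k + ℓ) - 2 * (k + ℓ)) * chiralCoeff (k : ℝ) (k * k - 2 * k)) *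
        ((2 ^ (k + ℓ + 1) * tailMajor Λ (N + (k + ℓ) + 1)) *
          (2 * (∑ m ∈ range N, (1 / 2 : ℝ) ^ m * (((m + Λ + (k + ℓ) + 1).choose Λ : ℕ) : ℝ)) +
            2 ^ (k + ℓ + 1) * tailMajor Λ (N + (k + ℓ) + 1))) := by
  have hφ := isTaylorFunctional_taylorFunctional2D (1 / 2) S w
  set c : ℕ := k + ℓ with hc
  have hcpos : 0 < c := by omega
  set HM : ℝ := ∑ m ∈ range N, (1 / 2 : ℝ) ^ m * (((m + Λ + c + 1).choose Λ : ℕ) : ℝ) with hHM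
  have hx0 : (0 : ℝ) < 1 / 2 := by norm_num
  have hx1 : (1 / 2 : ℝ) < 1 := by norm_num
  have hρ0 : (0 : ℝ) < 1 / 2 * (1 - 1 / 2) / 2 := by norm_num
  have hρ : (1 / 2 : ℝ) * (1 - 1 / 2) / 2 < 1 / 2 * (1 - 1 / 2) := by norm_num
  have hs := hφ.hasSum_mul_of_hasSummableGerms hρ0 (hasSummableGerms_pairPow hℓΔ s hx0 hx1 hρ0 hρ)
    (crossF s (-1) (globalBlock Δ ℓ)) (fun h' k' hh hk =>
      hasSum_crossF_globalBlock hℓΔ (mem_Ioo_of_abs_lt (hh.trans hρ)) (mem_Ioo_of_abs_lt (hk.trans hρ)))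
  set φ' := taylorFunctional2D (1 / 2) S w with hφ'
  set F : ℕ × ℕ → ℝ := fun mm => chiralCoeff ((Δ + ℓ) / 2) mm.1 * chiralCoeff ((Δ - ℓ) / 2) mm.2 *
    φ' (crossF s (-1) (pairPow ((Δ + ℓ) / 2 + (mm.1 : ℝ)) ((Δ - ℓ) / 2 + (mm.2 : ℝ)))) with hF
  have hsF : HasSum F (φ' (crossF s (-1) (globalBlock Δ ℓ))) := hs
  set Ac : ℝ := chiralCoeff (c : ℝ) (c * c - 2 * c) with hAc
  set Ak : ℝ := chiralCoeff (k : ℝ) (k * k - 2 * k) with hAk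
  set A : ℝ := Ac * Ak with hA
  set C0 : ℝ := (1 / 2 : ℝ) ^ s * (1 / 2 : ℝ) ^ s with hC0
  set K : ℝ := C0 * (1 / 2 : ℝ) ^ Δ * (2 * absWeight S w) * A with hK
  set t : ℕ → ℝ := fun m => (1 / 2 : ℝ) ^ m * (((m + Λ + c + 1).choose Λ : ℕ) : ℝ) with ht
  have hℓ0 : (0 : ℝ) ≤ ℓ := Nat.cast_nonneg ℓ
  have hh0 : 0 ≤ (Δ + ℓ) / 2 := by linarith
  have hhb0 : 0 ≤ (Δ - ℓ) / 2 := by linarith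
  have hhc : (Δ + ℓ) / 2 ≤ (c : ℝ) := by rw [hc]; push_cast; linarith
  have hhbk : (Δ - ℓ) / 2 ≤ (k : ℝ) := by linarith
  have hAc1 : 1 ≤ Ac := one_le_chiralCoeff_peak hcpos
  have hAk1 : 1 ≤ Ak := one_le_chiralCoeff_peak hk
  have hAc0 : 0 ≤ Ac := zero_le_one.trans hAc1
  have hAk0 : 0 ≤ Ak := zero_le_one.trans hAk1
  have hA0 : 0 ≤ A := mul_nonneg hAc0 hAk0
  have hC0nn : 0 ≤ C0 := by rw [hC0]; positivity
  have hDpos : 0 < (1 / 2 : ℝ) ^ Δ := Real.rpow_pos_of_pos (by norm_num) _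
  have hKnn : 0 ≤ K := by rw [hK]; have := absWeight_nonneg S w; positivity
  have ht0 : ∀ m, 0 ≤ t m := fun m => by rw [ht]; positivity
  have haA : ∀ m, chiralCoeff ((Δ + ℓ) / 2) m ≤ Ac := fun m => chiralCoeff_le_peak hcpos hh0 hhc m
  have haB : ∀ m, chiralCoeff ((Δ - ℓ) / 2) m ≤ Ak := fun m => chiralCoeff_le_peak hk hhb0 hhbk m
  have hΔsplit : (1 / 2 : ℝ) ^ Δ = (1 / 2 : ℝ) ^ ((Δ + ℓ) / 2) * (1 / 2 : ℝ) ^ ((Δ - ℓ) / 2) := by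
    rw [← Real.rpow_add (by norm_num)]; ring_nf
  -- (1) termwise bound `|F (m,m')| ≤ K t_m t_{m'}`
  have hbound : ∀ mm : ℕ × ℕ, |F mm| ≤ K * (t mm.1 * t mm.2) := by
    intro mm
    obtain ⟨m, m'⟩ := mm
    have ha : 0 ≤ chiralCoeff ((Δ + ℓ) / 2) m * chiralCoeff ((Δ - ℓ) / 2) m' :=
      mul_nonneg (chiralCoeff_nonneg hh0 _) (chiralCoeff_nonneg hhb0 _)
    have haA2 : chiralCoeff ((Δ + ℓ) / 2) m * chiralCoeff ((Δ - ℓ) / 2) m' ≤ A := by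
      rw [hA]
      exact mul_le_mul (haA m) (haB m') (chiralCoeff_nonneg hhb0 _) hAc0
    -- the pair monomial in the form `pairPow (b + J) b`, `b` = the smaller exponent
    have hval : |φ' (crossF s (-1) (pairPow ((Δ + ℓ) / 2 + (m : ℝ)) ((Δ - ℓ) / 2 + (m' : ℝ))))| ≤
        C0 * (1 / 2 : ℝ) ^ Δ * (2 * absWeight S w) * (t m * t m') := by
      rcases le_or_gt m' (ℓ + m) with hle | hgt
      · -- `b = h̄ + m'`, `J = ℓ + m - m'`, `n_b = m' + k`
        obtain ⟨J, hJ⟩ : ∃ J : ℕ, ℓ + m = m' + J := ⟨ℓ + m - m', by omega⟩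
        have hb : 0 ≤ (Δ - ℓ) / 2 + (m' : ℝ) := by positivity
        have hbn : (Δ - ℓ) / 2 + (m' : ℝ) ≤ ((m' + k : ℕ) : ℝ) := by push_cast; linarith
        have hv := abs_taylorFunctional2D_half_pairPow_le_real S w hs0 hs1 hΛ hb hbn J
        have e1 : (Δ - ℓ) / 2 + (m' : ℝ) + (J : ℝ) = (Δ + ℓ) / 2 + (m : ℝ) := by
          have : ((ℓ : ℕ) : ℝ) + (m : ℝ) = (m' : ℝ) + (J : ℝ) := by exact_mod_cast hJ
          linarith
        rw [e1] at hv
        refine hv.trans ?_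
        have e2 : (1 / 2 : ℝ) ^ ((Δ + ℓ) / 2 + (m : ℝ)) * (1 / 2 : ℝ) ^ ((Δ - ℓ) / 2 + (m' : ℝ)) =
            (1 / 2 : ℝ) ^ Δ * ((1 / 2 : ℝ) ^ m * (1 / 2 : ℝ) ^ m') := by
          rw [Real.rpow_add_natCast (by norm_num), Real.rpow_add_natCast (by norm_num), ← Real.rpow_natCast,
            ← Real.rpow_natCast, hΔsplit]
          ring
        have hi1 : m' + k + J + Λ + 1 = m + Λ + c + 1 := by omega
        have hi2 : (((m' + k + Λ + 1).choose Λ : ℕ) : ℝ) ≤ (((m' + Λ + c + 1).choose Λ : ℕ) : ℝ) := by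
          exact_mod_cast Nat.choose_le_choose Λ (by omega)
        rw [hi1] at *
        have hW := absWeight_nonneg S w
        have hP : 0 ≤ (1 / 2 : ℝ) ^ s * (1 / 2 : ℝ) ^ s * (1 / 2 : ℝ) ^ ((Δ + ℓ) / 2 + (m : ℝ)) *
            (1 / 2 : ℝ) ^ ((Δ - ℓ) / 2 + (m' : ℝ)) * (2 * (((m + Λ + c + 1).choose Λ : ℕ) : ℝ)) * absWeight S w := by
          positivity
        calc (1 / 2 : ℝ) ^ s * (1 / 2 : ℝ) ^ s * (1 / 2 : ℝ) ^ ((Δ + ℓ) / 2 + (m : ℝ)) * (1 / 2 : ℝ) ^ ((Δ - ℓ) / 2 + (m' : ℝ)) *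
              (2 * (((m + Λ + c + 1).choose Λ : ℕ) : ℝ) * (((m' + k + Λ + 1).choose Λ : ℕ) : ℝ) * absWeight S w)
            = (1 / 2 : ℝ) ^ s * (1 / 2 : ℝ) ^ s * (1 / 2 : ℝ) ^ ((Δ + ℓ) / 2 + (m : ℝ)) * (1 / 2 : ℝ) ^ ((Δ - ℓ) / 2 + (m' : ℝ)) *
              (2 * (((m + Λ + c + 1).choose Λ : ℕ) : ℝ)) * absWeight S w * (((m' + k + Λ + 1).choose Λ : ℕ) : ℝ) := by ring
          _ ≤ (1 / 2 : ℝ) ^ s * (1 / 2 : ℝ) ^ s * (1 / 2 : ℝ) ^ ((Δ + ℓ) / 2 + (m : ℝ)) * (1 / 2 : ℝ) ^ ((Δ - ℓ) / 2 + (m' : ℝ)) *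
              (2 * (((m + Λ + c + 1).choose Λ : ℕ) : ℝ)) * absWeight S w * (((m' + Λ + c + 1).choose Λ : ℕ) : ℝ) :=
            mul_le_mul_of_nonneg_left hi2 hP
          _ = (1 / 2 : ℝ) ^ s * (1 / 2 : ℝ) ^ s *
              ((1 / 2 : ℝ) ^ ((Δ + ℓ) / 2 + (m : ℝ)) * (1 / 2 : ℝ) ^ ((Δ - ℓ) / 2 + (m' : ℝ))) *
              (2 * (((m + Λ + c + 1).choose Λ : ℕ) : ℝ) * (((m' + Λ + c + 1).choose Λ : ℕ) : ℝ) * absWeight S w) := by ring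
          _ = C0 * (1 / 2 : ℝ) ^ Δ * (2 * absWeight S w) * (t m * t m') := by rw [e2, hC0, ht]; ring
      · -- `b = h + m`, `J = m' - ℓ - m`, `n_b = m + c`
        obtain ⟨J, hJ⟩ : ∃ J : ℕ, m' = ℓ + m + J := ⟨m' - (ℓ + m), by omega⟩
        have hb : 0 ≤ (Δ + ℓ) / 2 + (m : ℝ) := by positivity
        have hbn : (Δ + ℓ) / 2 + (m : ℝ) ≤ ((m + c : ℕ) : ℝ) := by push_cast; linarith
        have hv := abs_taylorFunctional2D_half_pairPow_le_real S w hs0 hs1 hΛ hb hbn J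
        have e1 : (Δ + ℓ) / 2 + (m : ℝ) + (J : ℝ) = (Δ - ℓ) / 2 + (m' : ℝ) := by
          have : (m' : ℝ) = ((ℓ : ℕ) : ℝ) + (m : ℝ) + (J : ℝ) := by exact_mod_cast hJ
          linarith
        rw [e1] at hv
        rw [show pairPow ((Δ + ℓ) / 2 + (m : ℝ)) ((Δ - ℓ) / 2 + (m' : ℝ)) =
            pairPow ((Δ - ℓ) / 2 + (m' : ℝ)) ((Δ + ℓ) / 2 + (m : ℝ)) from
          funext fun z => funext fun zb => pairPow_comm _ _ z zb]
        refine hv.trans ?_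
        have e2 : (1 / 2 : ℝ) ^ ((Δ - ℓ) / 2 + (m' : ℝ)) * (1 / 2 : ℝ) ^ ((Δ + ℓ) / 2 + (m : ℝ)) =
            (1 / 2 : ℝ) ^ Δ * ((1 / 2 : ℝ) ^ m * (1 / 2 : ℝ) ^ m') := by
          rw [Real.rpow_add_natCast (by norm_num), Real.rpow_add_natCast (by norm_num), ← Real.rpow_natCast,
            ← Real.rpow_natCast, hΔsplit]
          ring
        have hi1 : m + c + Λ + 1 = m + Λ + c + 1 := by omega
        have hi2 : (((m + c + J + Λ + 1).choose Λ : ℕ) : ℝ) ≤ (((m' + Λ + c + 1).choose Λ : ℕ) : ℝ) := by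
          exact_mod_cast Nat.choose_le_choose Λ (by omega)
        rw [hi1] at *
        have hW := absWeight_nonneg S w
        have hP : 0 ≤ (1 / 2 : ℝ) ^ s * (1 / 2 : ℝ) ^ s * (1 / 2 : ℝ) ^ ((Δ - ℓ) / 2 + (m' : ℝ)) *
            (1 / 2 : ℝ) ^ ((Δ + ℓ) / 2 + (m : ℝ)) * (2 * (((m + Λ + c + 1).choose Λ : ℕ) : ℝ)) * absWeight S w := by
          positivity
        calc (1 / 2 : ℝ) ^ s * (1 / 2 : ℝ) ^ s * (1 / 2 : ℝ) ^ ((Δ - ℓ) / 2 + (m' : ℝ)) * (1 / 2 : ℝ) ^ ((Δ + ℓ) / 2 + (m : ℝ)) *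
              (2 * (((m + c + J + Λ + 1).choose Λ : ℕ) : ℝ) * (((m + Λ + c + 1).choose Λ : ℕ) : ℝ) * absWeight S w)
            = (1 / 2 : ℝ) ^ s * (1 / 2 : ℝ) ^ s * (1 / 2 : ℝ) ^ ((Δ - ℓ) / 2 + (m' : ℝ)) * (1 / 2 : ℝ) ^ ((Δ + ℓ) / 2 + (m : ℝ)) *
              (2 * (((m + Λ + c + 1).choose Λ : ℕ) : ℝ)) * absWeight S w * (((m + c + J + Λ + 1).choose Λ : ℕ) : ℝ) := by ring
          _ ≤ (1 / 2 : ℝ) ^ s * (1 / 2 : ℝ) ^ s * (1 / 2 : ℝ) ^ ((Δ - ℓ) / 2 + (m' : ℝ)) * (1 / 2 : ℝ) ^ ((Δ + ℓ) / 2 + (m : ℝ)) *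
              (2 * (((m + Λ + c + 1).choose Λ : ℕ) : ℝ)) * absWeight S w * (((m' + Λ + c + 1).choose Λ : ℕ) : ℝ) :=
            mul_le_mul_of_nonneg_left hi2 hP
          _ = (1 / 2 : ℝ) ^ s * (1 / 2 : ℝ) ^ s *
              ((1 / 2 : ℝ) ^ ((Δ - ℓ) / 2 + (m' : ℝ)) * (1 / 2 : ℝ) ^ ((Δ + ℓ) / 2 + (m : ℝ))) *
              (2 * (((m + Λ + c + 1).choose Λ : ℕ) : ℝ) * (((m' + Λ + c + 1).choose Λ : ℕ) : ℝ) * absWeight S w) := by ring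
          _ = C0 * (1 / 2 : ℝ) ^ Δ * (2 * absWeight S w) * (t m * t m') := by rw [e2, hC0, ht]; ring
    have hKt : 0 ≤ C0 * (1 / 2 : ℝ) ^ Δ * (2 * absWeight S w) * (t m * t m') := by
      have := ht0 m; have := ht0 m'; have := absWeight_nonneg S w; positivity
    calc |F (m, m')| = chiralCoeff ((Δ + ℓ) / 2) m * chiralCoeff ((Δ - ℓ) / 2) m' *
          |φ' (crossF s (-1) (pairPow ((Δ + ℓ) / 2 + (m : ℝ)) ((Δ - ℓ) / 2 + (m' : ℝ))))| := by
            simp only [hF]; rw [abs_mul, abs_of_nonneg ha]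
      _ ≤ chiralCoeff ((Δ + ℓ) / 2) m * chiralCoeff ((Δ - ℓ) / 2) m' *
          (C0 * (1 / 2 : ℝ) ^ Δ * (2 * absWeight S w) * (t m * t m')) := mul_le_mul_of_nonneg_left hval ha
      _ ≤ A * (C0 * (1 / 2 : ℝ) ^ Δ * (2 * absWeight S w) * (t m * t m')) := mul_le_mul_of_nonneg_right haA2 hKt
      _ = K * (t m * t m') := by rw [hK]; ring
  -- (2) the majorant family is summable with sum `K S²`, `S = Σ t`
  obtain ⟨hts, htail⟩ := tsum_tail_le_tailMajor (Λ := Λ) (M := N + c + 1) (by omega)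
  have h2c : (2 : ℝ) ^ (c + 1) * (1 / 2 : ℝ) ^ (c + 1) = 1 := by rw [← mul_pow]; norm_num
  have hshift : ∀ j : ℕ, t (j + N) = 2 ^ (c + 1) * ((1 / 2 : ℝ) ^ (j + (N + c + 1)) * ((j + (N + c + 1) + Λ).choose Λ : ℝ)) := by
    intro j
    have e : (1 / 2 : ℝ) ^ (j + (N + c + 1)) = (1 / 2 : ℝ) ^ (j + N) * (1 / 2 : ℝ) ^ (c + 1) := by
      rw [← pow_add, show j + N + (c + 1) = j + (N + c + 1) by ring]
    rw [ht, e, show j + (N + c + 1) + Λ = j + N + Λ + c + 1 by ring]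
    simp only
    calc (1 / 2 : ℝ) ^ (j + N) * (((j + N + Λ + c + 1).choose Λ : ℕ) : ℝ)
        = (2 ^ (c + 1) * (1 / 2 : ℝ) ^ (c + 1)) * ((1 / 2 : ℝ) ^ (j + N) * (((j + N + Λ + c + 1).choose Λ : ℕ) : ℝ)) := by
          rw [h2c, one_mul]
      _ = 2 ^ (c + 1) * ((1 / 2 : ℝ) ^ (j + N) * (1 / 2 : ℝ) ^ (c + 1) * (((j + N + Λ + c + 1).choose Λ : ℕ) : ℝ)) := by ring
  have htN : Summable fun j : ℕ => t (j + N) := by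
    have := hts.mul_left (2 ^ (c + 1))
    refine this.congr fun j => ?_
    rw [hshift]
  have htsum : Summable t := (summable_nat_add_iff N).mp htN
  set Ssum : ℝ := ∑' m, t m with hS
  have hSN : Ssum = HM + ∑' j, t (j + N) := by
    rw [hS, hHM, ← Summable.sum_add_tsum_nat_add N htsum]
  have hTle : ∑' j, t (j + N) ≤ 2 ^ (c + 1) * tailMajor Λ (N + c + 1) := by
    calc ∑' j, t (j + N) = ∑' j, 2 ^ (c + 1) * ((1 / 2 : ℝ) ^ (j + (N + c + 1)) * ((j + (N + c + 1) + Λ).choose Λ : ℝ)) :=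
          tsum_congr hshift
      _ = 2 ^ (c + 1) * ∑' j, (1 / 2 : ℝ) ^ (j + (N + c + 1)) * ((j + (N + c + 1) + Λ).choose Λ : ℝ) := tsum_mul_left
      _ ≤ 2 ^ (c + 1) * tailMajor Λ (N + c + 1) := mul_le_mul_of_nonneg_left htail (by positivity)
  have hT0 : 0 ≤ ∑' j, t (j + N) := tsum_nonneg fun j => ht0 _
  have hH0 : 0 ≤ HM := by rw [hHM]; exact Finset.sum_nonneg fun m _ => ht0 m
  have hG : HasSum (fun mm : ℕ × ℕ => K * (t mm.1 * t mm.2)) (K * (Ssum * Ssum)) := by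
    have h1 := htsum.hasSum.mul htsum.hasSum (htsum.mul_of_nonneg htsum ht0 ht0)
    exact h1.mul_left K
  -- (3) kept square = `φ[Q_N]` for `F`, `K S_N²` for the majorant
  set R : Finset (ℕ × ℕ) := range N ×ˢ range N with hR
  have hQ : ∑ mm ∈ R, F mm = φ' (crossF s (-1) (QN N ℓ Δ)) := by
    have hT := TN_eq_phi_QN φ' s N ℓ Δ
    rw [← hT, hR, Finset.sum_product]
  have hRG : ∑ mm ∈ R, K * (t mm.1 * t mm.2) = K * (HM * HM) := by
    rw [hR, ← Finset.mul_sum, Finset.sum_product, hHM, Finset.sum_mul_sum]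
  -- (4) compare the complements, both signs
  have hFc : HasSum (fun x : {x // x ∉ R} => F x) (φ' (crossF s (-1) (globalBlock Δ ℓ)) - ∑ mm ∈ R, F mm) :=
    (Finset.hasSum_iff_compl R).mp hsF
  have hFcn : HasSum (fun x : {x // x ∉ R} => -F x) (-(φ' (crossF s (-1) (globalBlock Δ ℓ)) - ∑ mm ∈ R, F mm)) :=
    hFc.neg
  have hGc : HasSum (fun x : {x // x ∉ R} => K * (t x.1.1 * t x.1.2))
      (K * (Ssum * Ssum) - ∑ mm ∈ R, K * (t mm.1 * t mm.2)) :=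
    (Finset.hasSum_iff_compl R).mp hG
  have hcmp := hasSum_le (fun x : {x // x ∉ R} => (le_abs_self _).trans (hbound x.1)) hFc hGc
  have hcmpn := hasSum_le (fun x : {x // x ∉ R} => (neg_le_abs _).trans (hbound x.1)) hFcn hGc
  rw [hQ, hRG] at hcmp hcmpn
  -- (5) `S² - S_N² ≤ σ(2 S_N + σ)`
  set σ : ℝ := (2 : ℝ) ^ (c + 1) * tailMajor Λ (N + c + 1) with hσ
  have hσ0 : 0 ≤ σ := hT0.trans hTle
  have hsq : Ssum * Ssum - HM * HM ≤ σ * (2 * HM + σ) := by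
    rw [hSN]
    have e : (HM + ∑' j, t (j + N)) * (HM + ∑' j, t (j + N)) - HM * HM =
        (∑' j, t (j + N)) * (2 * HM + ∑' j, t (j + N)) := by ring
    rw [e]
    exact mul_le_mul hTle (by linarith) (by linarith) hσ0
  have hfin : K * (Ssum * Ssum) - K * (HM * HM) ≤ K * (σ * (2 * HM + σ)) := by
    rw [← mul_sub]; exact mul_le_mul_of_nonneg_left hsq hKnn
  have h1 : φ' (crossF s (-1) (globalBlock Δ ℓ)) - φ' (crossF s (-1) (QN N ℓ Δ)) ≤ K * (σ * (2 * HM + σ)) :=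
    hcmp.trans hfin
  have h2 : -(φ' (crossF s (-1) (globalBlock Δ ℓ)) - φ' (crossF s (-1) (QN N ℓ Δ))) ≤ K * (σ * (2 * HM + σ)) := by
    have := hcmpn.trans hfin; linarith
  have habs : |φ' (crossF s (-1) (globalBlock Δ ℓ)) - φ' (crossF s (-1) (QN N ℓ Δ))| ≤ K * (σ * (2 * HM + σ)) :=
    abs_le.mpr ⟨by linarith, by linarith⟩
  refine habs.trans (le_of_eq ?_)
  rw [hK, hC0, hA, hAc, hAk, hσ]

end Summit.CriticalPhenomena.Ising3D.Control2D
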